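import Summits.AnomalousDissipation.AnomalousDissipation.Theorems.DopplerClockLaminarStreaksSteady

/-!
# Route DopplerClock (AnomalousDissipation) — support item `LaminarStreaks`
# (stmt-AnomalousDissipation-18132), part II: momentum, energy, and the item

For `V, ν > 0`, `n ≥ 1` (and all `F`, `m`) the inertia-limited streak array
`u_L = V e₂ + sin(2πm x₁) [a cos(2πn x₂) + b sin(2πn x₂)] e₀`, `a = Fνκ²/D`, `b = FV(2πn)/D`,
`D = V²(2πn)² + ν²κ⁴`, `κ² = (2π)²(m²+n²)`, with zero pressure is a classical steady solution of
`NS_ν` forced by `F sin(2πm x₁) cos(2πn x₂) e₀` on `ℝ × T³` (part I,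
`DopplerStreaks.isClassicalNSSolutionOn_streaks`: the displayed `a`, `b` solve the two scalar
relations), has momentum `V e₂`, and kinetic energy `≤ V²/2 + F²/(8V²(2πn)²)` uniformly in `ν`.

**Proof of the last two clauses.** The momentum is `V e₂` because the two patterns are combinations
of Stokes modes at the non-zero frequencies `m e₁ ± n e₂`, which have zero mean. For the energy,
`‖u_L‖² = V² + w²` with `w = Im e_M (a Re e_N + b Im e_N)`, and
`w² = (a²+b²)/4 − (a²+b²)/4 · Re e_{2M} + Q` where `Q` is odd under the translation
`x₂ ↦ x₂ + 1/(4n)` (it carries a factor `Re e_{2N}` or `Im e_{2N}`, and `e_{2N}(x + e₂/(4n)) =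
−e_{2N}(x)`), so `∫ Q = 0` by translation invariance of the Haar measure, while
`∫ Re e_{2M} ∈ {0, 1}`; hence `∫ w² ≤ (a² + b²)/4 = F²/(4D) ≤ F²/(4 V² (2πn)²)`.

References: Foias–Manley–Rosa–Temam 2001, Ch. II §2; Constantin–Foias 1988, Ch. 4 (4.33) (Stokes
modes have zero mean); Grafakos 2014, §3.1.1 (characters and translations of `T^d`). No new
definitions.
-/

noncomputable section

-- `Summit.<Summit>.<Problem>` is the tree's mandated summit-side namespace (CONVENTIONS §2); for this
-- single-conjunct summit the two coincide, so the duplicate is deliberate.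
set_option linter.dupNamespace false

open MeasureTheory Set Filter Topology UnitAddTorus
open scoped InnerProductSpace RealInnerProductSpace

namespace Summit.AnomalousDissipation.AnomalousDissipation.Theorems

open Literature.Analysis.FluidPDE Literature.Analysis.FluidPDE.Torus
open Literature.Analysis.FunctionSpaces Literature.Analysis.FunctionSpaces.Torus

namespace DopplerStreaks

/-- The flat three-torus (local notation). -/
local notation "𝕋³" => UnitAddTorus (Fin 3)
/-- The streamwise unit vector `e₀` (local notation). -/
local notation "𝐞₀" => EuclideanSpace.single (0 : Fin 3) (1 : ℝ)
/-- The drift direction `e₂` (local notation). -/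
local notation "𝐞₂" => EuclideanSpace.single (2 : Fin 3) (1 : ℝ)
/-- The character `e_{m e₁}(x) = exp(2πi m x₁)` (local notation). -/
local notation:max "χ₁" m:max => UnitAddTorus.mFourier (Pi.single (1 : Fin 3) ((m : ℕ) : ℤ))
/-- The character `e_{n e₂}(x) = exp(2πi n x₂)` (local notation). -/
local notation:max "χ₂" n:max => UnitAddTorus.mFourier (Pi.single (2 : Fin 3) ((n : ℕ) : ℤ))

/-! ### Momentum and energy of the streak array -/

/-- `m e₁ + n e₂ ≠ 0` for `n ≠ 0`. [folklore] -/
theorem single_add_single_ne_zero (m : ℕ) {n : ℕ} (hn : n ≠ 0) :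
    (Pi.single (1 : Fin 3) (m : ℤ) + Pi.single (2 : Fin 3) (n : ℤ) : Fin 3 → ℤ) ≠ 0 := by
  intro h
  have h2 := congrFun h 2
  simp at h2
  exact hn h2

/-- `m e₁ − n e₂ ≠ 0` for `n ≠ 0`. [folklore] -/
theorem single_sub_single_ne_zero (m : ℕ) {n : ℕ} (hn : n ≠ 0) :
    (Pi.single (1 : Fin 3) (m : ℤ) - Pi.single (2 : Fin 3) (n : ℤ) : Fin 3 → ℤ) ≠ 0 := by
  intro h
  have h2 := congrFun h 2
  simp at h2
  exact hn h2

/-- **Momentum of the streak array**: `∫ u_L = V e₂` (the two patterns are combinations of Stokes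
modes at the non-zero frequencies `m e₁ ± n e₂`, which have zero mean). [folklore] -/
theorem integral_streaks (V a b : ℝ) (m : ℕ) {n : ℕ} (hn : n ≠ 0) :
    ∫ x : 𝕋³, (V • 𝐞₂ + ((χ₁ m x).im * (a * (χ₂ n x).re + b * (χ₂ n x).im)) • 𝐞₀) = V • 𝐞₂ := by
  have hKp := single_add_single_ne_zero m hn
  have hKm := single_sub_single_ne_zero m hn
  -- the two patterns have zero mean
  have Ic : ∫ x : 𝕋³, ((χ₁ m x).im * (χ₂ n x).re) • 𝐞₀ = 0 := by
    rw [sinCos_eq_stokesModes, integral_smul,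
      integral_add (stokesMode _ _ _).continuous.integrable_unitAddTorus
        (stokesMode _ _ _).continuous.integrable_unitAddTorus]
    have h1 : ∫ x : 𝕋³, stokesMode (Pi.single (1 : Fin 3) (m : ℤ) + Pi.single (2 : Fin 3) (n : ℤ))
        𝐞₀ false x = 0 := hasZeroMean_stokesMode hKp 𝐞₀ false
    have h2 : ∫ x : 𝕋³, stokesMode (Pi.single (1 : Fin 3) (m : ℤ) - Pi.single (2 : Fin 3) (n : ℤ))
        𝐞₀ false x = 0 := hasZeroMean_stokesMode hKm 𝐞₀ false
    rw [h1, h2, add_zero, smul_zero]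
  have Is : ∫ x : 𝕋³, ((χ₁ m x).im * (χ₂ n x).im) • 𝐞₀ = 0 := by
    rw [DopplerWork.pattern_eq_stokesModes, integral_smul,
      integral_add (stokesMode _ _ _).continuous.integrable_unitAddTorus
        (stokesMode _ _ _).continuous.integrable_unitAddTorus]
    have h1 : ∫ x : 𝕋³, stokesMode (Pi.single (1 : Fin 3) (m : ℤ) - Pi.single (2 : Fin 3) (n : ℤ))
        𝐞₀ true x = 0 := hasZeroMean_stokesMode hKm 𝐞₀ true
    have h2 : ∫ x : 𝕋³, stokesMode (Pi.single (1 : Fin 3) (m : ℤ) + Pi.single (2 : Fin 3) (n : ℤ))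
        (-𝐞₀) true x = 0 := hasZeroMean_stokesMode hKp (-𝐞₀) true
    rw [h1, h2, add_zero, smul_zero]
  have hpt : ∀ x : 𝕋³, V • 𝐞₂ + ((χ₁ m x).im * (a * (χ₂ n x).re + b * (χ₂ n x).im)) • 𝐞₀ =
      V • 𝐞₂ + (a • (((χ₁ m x).im * (χ₂ n x).re) • 𝐞₀) +
        b • (((χ₁ m x).im * (χ₂ n x).im) • 𝐞₀)) := by
    intro x
    simp only [smul_smul, ← add_smul]
    congr 2
    ring
  have ic : Integrable (fun x : 𝕋³ => a • (((χ₁ m x).im * (χ₂ n x).re) • 𝐞₀)) volume :=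
    Continuous.integrable_unitAddTorus (by fun_prop)
  have is : Integrable (fun x : 𝕋³ => b • (((χ₁ m x).im * (χ₂ n x).im) • 𝐞₀)) volume :=
    Continuous.integrable_unitAddTorus (by fun_prop)
  simp_rw [hpt]
  rw [integral_add (integrable_const _), integral_add ic is, integral_smul a,
    integral_smul b, Ic, Is, smul_zero, smul_zero, add_zero, add_zero]
  · simp
  · exact ic.add is

/-- **The squared streak profile in characters**: with `w = Im e_k (a Re e_l + b Im e_l)`,
`w² = (a²+b²)/4 − (a²+b²)/4 · Re e_{2k} + Q`, `Q` a combination of `Re e_{2l}`, `Im e_{2l}`,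
`Re e_{2k} Re e_{2l}`, `Re e_{2k} Im e_{2l}` (`|e_k| = |e_l| = 1`, `e_{2k} = e_k²`). [folklore] -/
theorem sq_profile (k l : Fin 3 → ℤ) (a b : ℝ) (x : 𝕋³) :
    ((mFourier k x).im * (a * (mFourier l x).re + b * (mFourier l x).im)) ^ 2 =
      (a ^ 2 + b ^ 2) / 4 - (a ^ 2 + b ^ 2) / 4 * (mFourier (k + k) x).re +
        ((a ^ 2 - b ^ 2) / 4 * (mFourier (l + l) x).re + a * b / 2 * (mFourier (l + l) x).im -
          (a ^ 2 - b ^ 2) / 4 * ((mFourier (k + k) x).re * (mFourier (l + l) x).re) -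
          a * b / 2 * ((mFourier (k + k) x).re * (mFourier (l + l) x).im)) := by
  have hk := DopplerWork.re_sq_add_im_sq_mFourier k x
  have hl := DopplerWork.re_sq_add_im_sq_mFourier l x
  simp only [mFourier_add, Complex.mul_re, Complex.mul_im]
  linear_combination ((a ^ 2 + b ^ 2) / 4 +
      (a ^ 2 - b ^ 2) / 4 * ((mFourier l x).re * (mFourier l x).re - (mFourier l x).im * (mFourier l x).im) +
      a * b * ((mFourier l x).re * (mFourier l x).im)) * hk +
    ((mFourier k x).im ^ 2 * ((a ^ 2 + b ^ 2) / 2)) * hl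

/-- `‖V e₂ + c e₀‖² = V² + c²` (orthogonality of the coordinate directions). [folklore] -/
theorem norm_sq_drift_add (V c : ℝ) : ‖V • 𝐞₂ + c • 𝐞₀‖ ^ 2 = V ^ 2 + c ^ 2 := by
  rw [EuclideanSpace.real_norm_sq_eq, Fin.sum_univ_three]
  simp
  ring

/-- `∫ Re e_K ≥ 0` for every frequency (`∫ e_K ∈ {0, 1}`). [folklore] -/
theorem integral_re_mFourier_nonneg (K : Fin 3 → ℤ) :
    0 ≤ ∫ x : 𝕋³, (mFourier K x).re := by
  have hint : Integrable (⇑(mFourier K)) (volume : Measure 𝕋³) :=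
    (mFourier K).continuous.integrable_unitAddTorus
  have h := Complex.reCLM.integral_comp_comm hint
  simp only [Complex.reCLM_apply] at h
  rw [h, integral_mFourier]
  split_ifs <;> simp

/-- **Mean square of the streak profile.** If `2lᵢ ≠ 0` and `kᵢ = 0`, the translation
`x ↦ x + eᵢ/(4lᵢ)` negates `e_{2l}` and fixes `e_{2k}`, so in `sq_profile` the bracket is odd, hence
has integral zero (invariance of the Haar measure), and `∫ Re e_{2k} ≥ 0`; therefore
`∫ (Im e_k (a Re e_l + b Im e_l))² ≤ (a² + b²)/4`. [folklore] -/
theorem integral_sq_profile_le (k l : Fin 3 → ℤ) (a b : ℝ) {i : Fin 3} (hl : (l + l) i ≠ 0)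
    (hk : (k + k) i = 0) :
    ∫ x : 𝕋³, ((mFourier k x).im * (a * (mFourier l x).re + b * (mFourier l x).im)) ^ 2 ≤
      (a ^ 2 + b ^ 2) / 4 := by
  -- the translation
  have hlt := fun x : 𝕋³ => AcdcDesign.mFourier_add_single_half hl x
  have hkt := fun x : 𝕋³ => AcdcDesign.mFourier_add_single_of_eq_zero hk
    (((1 : ℝ) / 2 / ((l + l) i : ℝ) : ℝ) : UnitAddCircle) x
  -- the odd remainder
  obtain ⟨Q, hQ⟩ : ∃ Q : 𝕋³ → ℝ, Q = fun x =>
      (a ^ 2 - b ^ 2) / 4 * (mFourier (l + l) x).re + a * b / 2 * (mFourier (l + l) x).im -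
        (a ^ 2 - b ^ 2) / 4 * ((mFourier (k + k) x).re * (mFourier (l + l) x).re) -
        a * b / 2 * ((mFourier (k + k) x).re * (mFourier (l + l) x).im) := ⟨_, rfl⟩
  have hQodd : ∀ x, Q (x + Pi.single i (((1 : ℝ) / 2 / ((l + l) i : ℝ) : ℝ) : UnitAddCircle)) = -Q x := by
    intro x
    simp only [hQ]
    rw [hlt x, hkt x, Complex.neg_re, Complex.neg_im]
    ring
  have IQ : ∫ x, Q x = 0 := AcdcDesign.integral_eq_zero_of_forall_add_eq_neg Q
    (Pi.single i (((1 : ℝ) / 2 / ((l + l) i : ℝ) : ℝ) : UnitAddCircle)) hQodd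
  have hsq : ∀ x : 𝕋³, ((mFourier k x).im * (a * (mFourier l x).re + b * (mFourier l x).im)) ^ 2 =
      ((a ^ 2 + b ^ 2) / 4 - (a ^ 2 + b ^ 2) / 4 * (mFourier (k + k) x).re) + Q x := by
    intro x
    rw [sq_profile, hQ]
  have i1 : Integrable (fun x : 𝕋³ =>
      (a ^ 2 + b ^ 2) / 4 - (a ^ 2 + b ^ 2) / 4 * (mFourier (k + k) x).re) volume :=
    Continuous.integrable_unitAddTorus (by fun_prop)
  have hQc : Continuous Q := by
    rw [hQ]
    fun_prop
  have ire : Integrable (fun x : 𝕋³ => (mFourier (k + k) x).re) volume :=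
    Continuous.integrable_unitAddTorus (by fun_prop)
  have hre := integral_re_mFourier_nonneg (k + k)
  have hab : 0 ≤ (a ^ 2 + b ^ 2) / 4 := by positivity
  simp_rw [hsq]
  rw [integral_add i1 hQc.integrable_unitAddTorus, IQ, add_zero,
    integral_sub (integrable_const _) (ire.const_mul _), integral_const_mul]
  simp only [integral_const, probReal_univ, smul_eq_mul, one_mul]
  nlinarith [mul_nonneg hab hre]

/-- **Energy of the streak array**: `½ ∫ ‖V e₂ + w e₀‖² ≤ V²/2 + (a² + b²)/8` for
`w = sin(2πm x₁) (a cos(2πn x₂) + b sin(2πn x₂))`, `n ≠ 0` (`‖V e₂ + w e₀‖² = V² + w²`, and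
`integral_sq_profile_le` with the translation `x₂ ↦ x₂ + 1/(4n)`). [folklore] -/
theorem kineticEnergy_streaks_le (V a b : ℝ) (m : ℕ) {n : ℕ} (hn : n ≠ 0) :
    kineticEnergy (fun x : 𝕋³ =>
        V • 𝐞₂ + ((χ₁ m x).im * (a * (χ₂ n x).re + b * (χ₂ n x).im)) • 𝐞₀) ≤
      V ^ 2 / 2 + (a ^ 2 + b ^ 2) / 8 := by
  have hll : (Pi.single (2 : Fin 3) (n : ℤ) + Pi.single (2 : Fin 3) (n : ℤ) : Fin 3 → ℤ) 2 ≠ 0 := by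
    simp
    omega
  have hkk : (Pi.single (1 : Fin 3) (m : ℤ) + Pi.single (1 : Fin 3) (m : ℤ) : Fin 3 → ℤ) 2 = 0 := by
    simp
  have hI := integral_sq_profile_le (Pi.single (1 : Fin 3) (m : ℤ)) (Pi.single (2 : Fin 3) (n : ℤ))
    a b hll hkk
  have hnorm : ∀ x : 𝕋³,
      ‖V • 𝐞₂ + ((χ₁ m x).im * (a * (χ₂ n x).re + b * (χ₂ n x).im)) • 𝐞₀‖ ^ 2 =
        V ^ 2 + ((χ₁ m x).im * (a * (χ₂ n x).re + b * (χ₂ n x).im)) ^ 2 := fun x =>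
    norm_sq_drift_add V _
  have isq : Integrable (fun x : 𝕋³ =>
      ((χ₁ m x).im * (a * (χ₂ n x).re + b * (χ₂ n x).im)) ^ 2) volume :=
    Continuous.integrable_unitAddTorus (by fun_prop)
  unfold kineticEnergy
  simp_rw [hnorm]
  rw [integral_add (integrable_const _) isq]
  simp only [integral_const, probReal_univ, smul_eq_mul, one_mul]
  nlinarith [hI]

end DopplerStreaks

/-- **`DopplerClock.LaminarStreaks` holds** (item stmt-AnomalousDissipation-18132): for `V, ν > 0`,
`n ≥ 1` (and all `F`, `m`) the inertia-limited streak array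
`u_L = V e₂ + sin(2πm x₁) [a cos(2πn x₂) + b sin(2πn x₂)] e₀`, `a = Fνκ²/D`, `b = FV(2πn)/D`,
`D = V²(2πn)² + ν²κ⁴`, `κ² = (2π)²(m²+n²)`, with zero pressure is a classical steady solution of
`NS_ν` forced by `F sin(2πm x₁) cos(2πn x₂) e₀` on `ℝ × T³`, has momentum `V e₂`, and kinetic energy
`≤ V²/2 + F²/(8V²(2πn)²)` (`a² + b² = F²/D ≤ F²/(V²(2πn)²)`). The route decl BY NAME, from
`DopplerStreaks.isClassicalNSSolutionOn_streaks`, `integral_streaks`, `kineticEnergy_streaks_le`.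
[folklore] -/
theorem dopplerClock_laminarStreaks_proof :
    Summit.AnomalousDissipation.AnomalousDissipation.Theses.DopplerClock.LaminarStreaks := by
  intro F V ν m n hV hν hn
  have hn0 : n ≠ 0 := Nat.pos_iff_ne_zero.1 hn
  have hω : 0 < 2 * Real.pi * (n : ℝ) := by positivity
  have hD : 0 < V ^ 2 * (2 * Real.pi * n) ^ 2 +
      ν ^ 2 * ((2 * Real.pi) ^ 2 * ((m : ℝ) ^ 2 + (n : ℝ) ^ 2)) ^ 2 := by positivity
  have hD' : V ^ 2 * (2 * Real.pi * n) ^ 2 +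
      ν ^ 2 * ((2 * Real.pi) ^ 2 * ((m : ℝ) ^ 2 + (n : ℝ) ^ 2)) ^ 2 ≠ 0 := hD.ne'
  refine ⟨DopplerStreaks.isClassicalNSSolutionOn_streaks F V ν _ _ m n ?_ ?_,
    DopplerStreaks.integral_streaks V _ _ m hn0,
    (DopplerStreaks.kineticEnergy_streaks_le V _ _ m hn0).trans ?_⟩
  · field_simp
  · field_simp
  · -- `a² + b² = F²/D ≤ F²/(V²(2πn)²)`
    have hsum : (F * ν * ((2 * Real.pi) ^ 2 * ((m : ℝ) ^ 2 + (n : ℝ) ^ 2)) /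
          (V ^ 2 * (2 * Real.pi * n) ^ 2 +
            ν ^ 2 * ((2 * Real.pi) ^ 2 * ((m : ℝ) ^ 2 + (n : ℝ) ^ 2)) ^ 2)) ^ 2 +
        (F * V * (2 * Real.pi * n) /
          (V ^ 2 * (2 * Real.pi * n) ^ 2 +
            ν ^ 2 * ((2 * Real.pi) ^ 2 * ((m : ℝ) ^ 2 + (n : ℝ) ^ 2)) ^ 2)) ^ 2 =
        F ^ 2 / (V ^ 2 * (2 * Real.pi * n) ^ 2 +
          ν ^ 2 * ((2 * Real.pi) ^ 2 * ((m : ℝ) ^ 2 + (n : ℝ) ^ 2)) ^ 2) := by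
      field_simp
      ring
    have hle : F ^ 2 / (V ^ 2 * (2 * Real.pi * n) ^ 2 +
          ν ^ 2 * ((2 * Real.pi) ^ 2 * ((m : ℝ) ^ 2 + (n : ℝ) ^ 2)) ^ 2) ≤
        F ^ 2 / (V ^ 2 * (2 * Real.pi * n) ^ 2) :=
      div_le_div_of_nonneg_left (sq_nonneg F) (by positivity) (by nlinarith [sq_nonneg (ν * ((2 * Real.pi) ^ 2 * ((m : ℝ) ^ 2 + (n : ℝ) ^ 2)))])
    rw [hsum]
    have h8 : F ^ 2 / (8 * V ^ 2 * (2 * Real.pi * n) ^ 2) = F ^ 2 / (V ^ 2 * (2 * Real.pi * n) ^ 2) / 8 := by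
      rw [div_div]
      ring
    rw [h8]
    linarith

end Summit.AnomalousDissipation.AnomalousDissipation.Theorems

end
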